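import Mathlib
import Summits.NavierStokesRegularity.NavierStokesRegularity.Theorems.RootDecompLitSliceMeanFieldOneStepAssembly
import Summits.NavierStokesRegularity.NavierStokesRegularity.Theorems.RootDecompLitSliceMeanFieldBootstrap
import HarnessLib

/-!
# Mean-field lever VII: the UNCONDITIONAL forms — clock rigidity `b ≤ 1/2` and «every vertex is energy-Type-(I−ε)»

Helper file for the crux `RootDecompLitSlice.CritTameScarIsCritical` (Uᶜ, stmt-…-31733). The files
`RootDecompLitSliceMeanFieldBootstrap` and `…MeanFieldClockRigidity` proved their ★-theorems MODULO one inserted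
antecedent, the mean-field one-step schema; `RootDecompLitSliceMeanFieldOneStepAssembly.meanFieldStep_b` /
`meanFieldStep` now PROVE that schema on the classical tame frame. This file discharges the antecedent:

* §1 the schemas as theorems: `oneStepSchema_sqrt` (`b = 1/2`: law `a ∈ [1/4, 1/2)` ⟹ law `Ψ(a)`),
  `oneStepSchema_b` (clock exponent `b > 1/2`: law `a ∈ [b/2, 1/2]` ⟹ law `min b Ψ_b(a)`).
* §2 on the classical tame frame (`ν > 0`, classical on `[0, T) × ℝ³`, Leray–Hopf on `[0, T]`, decaying datum)
  with the `√`-clock `∫‖u t − u T‖² ≤ K√(T − t)`: `energyLaw_lt_half_of_sqrtClock` — energy laws of EVERY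
  exponent `a < 1/2`; `scar_lt_one_of_sqrtClock` — terminal scars of EVERY order `α < 1` at every point,
  `∫_{B_r(x₀)}|u(T)|² ≤ C' r^α`.
* §3 cell forms on Uᶜ's frame VERBATIM (maximal smooth solution on `[0, T)`, Leray–Hopf, decaying datum, tame
  at `T`, `√`-clock): ★ `critTameScar_lt_one` (scars of every order `α < 1`; Uᶜ is the order `α = 1`) and
  `critTameVertex_typeI_eps` (parabolic-local dissipation `≤ C ρ^γ` for EVERY `γ < 1` at every vertex — the
  antecedent of `EnergyTypeIVertex.critTameScarIsCritical_of_parabolicDissipation` is the endpoint `γ = 1`).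
* §4 ★★ `no_clock_above_half` — CLOCK RIGIDITY, unconditional: on U's frame (maximal smooth solution,
  Leray–Hopf, decaying datum, tame at `T`) there is NO clock `∫‖u t − u T‖² ≤ K (T − t)^b` near `T` with
  `b > 1/2`; equivalently `clockExponent_le_half`: any such clock has `b ≤ 1/2`. The sub-cell `{b > 1/2}` of
  Uᶜ is empty and the clock window of record `{1/2 ≤ b < 5/8}` collapses to `{b = 1/2}`.

HONEST FRAMING (critic rows 726/728; census TREE PROBE #51): helpers INSIDE the Tao-vacuous, zero-load cell Uᶜ;
no item, no node, no load moves (ROOT ⟺ Uᵃ ∧ P1 unchanged); the endpoint `(b, a) = (1/2, 1/2)` = Uᶜ itself is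
NOT reached (the one-step gain `Ψ(a) − a` vanishes quadratically at `a = 1/2`; ENDPOINT ANATOMY in the writer's
notes). Rung 0: nothing here proves NS regularity. All statements are over accepted
`Literature.Analysis.FluidPDE` declarations and Mathlib; no new definitions.
[cite: ConstantinFoias1988, Ch. 6, Ch. 8; Galdi2000, Lemma 2.1; Leray1934, §34]
-/

set_option linter.dupNamespace false

namespace Summit.NavierStokesRegularity.NavierStokesRegularity.Theorems

open MeasureTheory Set Filter Topology Function Module
open scoped ENNReal NNReal RealInnerProductSpace
open Literature.Analysis.FluidPDE

namespace MeanFieldUnconditional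

variable {ν T : ℝ} {u : ℝ → EuclideanSpace ℝ (Fin 3) → EuclideanSpace ℝ (Fin 3)}
  {p : ℝ → EuclideanSpace ℝ (Fin 3) → ℝ}

/-! ## §1 The one-step schemas are theorems -/

/-- The `b = 1/2` one-step schema (antecedent `hstep` of `RootDecompLitSliceMeanFieldBootstrap`) HOLDS on the
classical tame frame with the `√`-clock. [folklore] -/
theorem oneStepSchema_sqrt (hν : 0 < ν) (hT : 0 < T)
    (hcl : IsClassicalNSSolutionOn (Ico 0 T) ν 0 u p) (hLH : IsLerayHopfOn T ν 0 (u 0) u)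
    (hclock : ∃ K T₁ : ℝ, T₁ < T ∧ ∀ t ∈ Ioo T₁ T,
      ∫⁻ x, ‖u t x - u T x‖ₑ ^ 2 ≤ ENNReal.ofReal (K * Real.sqrt (T - t))) :
    ∀ a : ℝ, 1 / 4 ≤ a → a < 1 / 2 →
      (∃ C T₂ : ℝ, T₂ < T ∧ ∀ t ∈ Ioo T₂ T,
        (∫ x, ‖u t x‖ ^ 2) - ∫ x, ‖u T x‖ ^ 2 ≤ C * (T - t) ^ a) →
      ∃ C T₂ : ℝ, T₂ < T ∧ ∀ t ∈ Ioo T₂ T,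
        (∫ x, ‖u t x‖ ^ 2) - ∫ x, ‖u T x‖ ^ 2 ≤ C * (T - t) ^ ((5 + 2 * a) / (4 * (5 - 4 * a))) :=
  fun _ ha1 ha2 hlaw => MeanFieldOneStepAssembly.meanFieldStep hν hT hcl hLH hclock ha1 ha2.le hlaw

/-- The one-step schema at a clock exponent `b > 1/2` (antecedent of
`MeanFieldClockRigidity.clockExponent_le_half_of_meanFieldStep`) HOLDS on the classical tame frame. [folklore] -/
theorem oneStepSchema_b (hν : 0 < ν) (hT : 0 < T)
    (hcl : IsClassicalNSSolutionOn (Ico 0 T) ν 0 u p) (hLH : IsLerayHopfOn T ν 0 (u 0) u)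
    {b : ℝ} (hb : 1 / 2 < b)
    (hclock : ∃ K T₁ : ℝ, T₁ < T ∧ ∀ t ∈ Ioo T₁ T,
      ∫⁻ x, ‖u t x - u T x‖ₑ ^ 2 ≤ ENNReal.ofReal (K * (T - t) ^ b)) :
    b ≤ 1 → ∀ a : ℝ, b / 2 ≤ a → a ≤ 1 / 2 →
      (∃ C T₂ : ℝ, T₂ < T ∧ ∀ t ∈ Ioo T₂ T,
        (∫ x, ‖u t x‖ ^ 2) - ∫ x, ‖u T x‖ ^ 2 ≤ C * (T - t) ^ a) →
      ∃ C T₂ : ℝ, T₂ < T ∧ ∀ t ∈ Ioo T₂ T,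
        (∫ x, ‖u t x‖ ^ 2) - ∫ x, ‖u T x‖ ^ 2 ≤
          C * (T - t) ^ min b (b * (3 + a - b) / (2 * (2 + b - 2 * a))) :=
  fun _ _ hab ha hlaw => MeanFieldOneStepAssembly.meanFieldStep_b hν hT hcl hLH hclock hb.le hab ha hlaw

/-! ## §2 Unconditional consequences of the `√`-clock on the classical tame frame -/

/-- **Energy laws of every exponent `a < 1/2`** from the `√`-clock (classical on `[0, T)`, Leray–Hopf, decaying
datum). [folklore] -/
theorem energyLaw_lt_half_of_sqrtClock (ν T : ℝ) (hν : 0 < ν) (hT : 0 < T)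
    (u : ℝ → EuclideanSpace ℝ (Fin 3) → EuclideanSpace ℝ (Fin 3)) (p : ℝ → EuclideanSpace ℝ (Fin 3) → ℝ)
    (hcl : IsClassicalNSSolutionOn (Ico 0 T) ν 0 u p) (hLH : IsLerayHopfOn T ν 0 (u 0) u)
    (hdec : HasRapidSpatialDecay (u 0))
    (hclock : ∃ K T₁ : ℝ, T₁ < T ∧ ∀ t ∈ Ioo T₁ T,
      ∫⁻ x, ‖u t x - u T x‖ₑ ^ 2 ≤ ENNReal.ofReal (K * Real.sqrt (T - t))) :
    ∀ a : ℝ, a < 1 / 2 → ∃ C T₂ : ℝ, T₂ < T ∧ ∀ t ∈ Ioo T₂ T,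
      (∫ x, ‖u t x‖ ^ 2) - ∫ x, ‖u T x‖ ^ 2 ≤ C * (T - t) ^ a :=
  MeanFieldBootstrap.energyLaw_lt_half_of_sqrtClock_of_meanFieldStep ν T hν hT u p hcl hLH hdec hclock
    (oneStepSchema_sqrt hν hT hcl hLH hclock)

/-- **Terminal scars of every sub-critical order** from the `√`-clock: for every `α < 1` and every `x₀`,
`∫_{B_r(x₀)}|u(T)|² ≤ C' r^α` for small `r`. [folklore] -/
theorem scar_lt_one_of_sqrtClock (ν T : ℝ) (hν : 0 < ν) (hT : 0 < T)
    (u : ℝ → EuclideanSpace ℝ (Fin 3) → EuclideanSpace ℝ (Fin 3)) (p : ℝ → EuclideanSpace ℝ (Fin 3) → ℝ)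
    (hcl : IsClassicalNSSolutionOn (Ico 0 T) ν 0 u p) (hLH : IsLerayHopfOn T ν 0 (u 0) u)
    (hdec : HasRapidSpatialDecay (u 0))
    (hclock : ∃ K T₁ : ℝ, T₁ < T ∧ ∀ t ∈ Ioo T₁ T,
      ∫⁻ x, ‖u t x - u T x‖ₑ ^ 2 ≤ ENNReal.ofReal (K * Real.sqrt (T - t))) :
    ∀ α : ℝ, α < 1 → ∀ x₀ : EuclideanSpace ℝ (Fin 3), ∃ C' r₁ : ℝ, 0 < r₁ ∧ ∀ r ∈ Ioo 0 r₁,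
      ∫ x in Metric.ball x₀ r, ‖u T x‖ ^ 2 ≤ C' * r ^ α :=
  MeanFieldBootstrap.scar_lt_one_of_sqrtClock_of_meanFieldStep ν T hν hT u p hcl hLH hdec hclock
    (oneStepSchema_sqrt hν hT hcl hLH hclock)

/-! ## §3 Cell forms on Uᶜ's frame -/

/-- ★ **Uᶜ's frame and `√`-clock VERBATIM ⟹ scars of every order `α < 1`** (Uᶜ is the order `α = 1`): no
inserted antecedent remains. [folklore] -/
theorem critTameScar_lt_one :
    ∀ (ν T : ℝ), 0 < ν → 0 < T → ∀ (u : ℝ → EuclideanSpace ℝ (Fin 3) → EuclideanSpace ℝ (Fin 3))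
      (p : ℝ → EuclideanSpace ℝ (Fin 3) → ℝ),
      Literature.Analysis.FluidPDE.IsMaximalSmoothSolution ν 0 u p T →
      Literature.Analysis.FluidPDE.IsLerayHopfOn T ν 0 (u 0) u →
      Literature.Analysis.FluidPDE.HasRapidSpatialDecay (u 0) →
      Filter.Tendsto (fun t => MeasureTheory.eLpNorm (u t - u T) 2 MeasureTheory.volume)
        (nhdsWithin T (Set.Iio T)) (nhds 0) →
      (∃ K T₁ : ℝ, T₁ < T ∧ ∀ t ∈ Set.Ioo T₁ T,
        ∫⁻ x, ‖u t x - u T x‖ₑ ^ 2 ≤ ENNReal.ofReal (K * Real.sqrt (T - t))) →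
      ∀ α : ℝ, α < 1 → ∀ x₀ : EuclideanSpace ℝ (Fin 3), ∃ C' r₁ : ℝ, 0 < r₁ ∧ ∀ r ∈ Set.Ioo 0 r₁,
        ∫ x in Metric.ball x₀ r, ‖u T x‖ ^ 2 ≤ C' * r ^ α :=
  fun ν T hν hT u p hmax hLH hdec htame hclock =>
    MeanFieldBootstrap.critTameScar_lt_one_of_meanFieldStep ν T hν hT u p hmax hLH hdec htame hclock
      (oneStepSchema_sqrt hν hT hmax.1 hLH hclock)

/-- **Uᶜ's frame and `√`-clock VERBATIM ⟹ every vertex is energy-Type-(I−ε)**: parabolic-local dissipation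
`∫_{T−ρ²}^{T}∫_{B_ρ(x₀)}|∇u|²_F ≤ C ρ^γ` for EVERY `γ < 1` (the endpoint `γ = 1` is the antecedent of
`EnergyTypeIVertex.critTameScarIsCritical_of_parabolicDissipation`). [folklore] -/
theorem critTameVertex_typeI_eps :
    ∀ (ν T : ℝ), 0 < ν → 0 < T → ∀ (u : ℝ → EuclideanSpace ℝ (Fin 3) → EuclideanSpace ℝ (Fin 3))
      (p : ℝ → EuclideanSpace ℝ (Fin 3) → ℝ),
      Literature.Analysis.FluidPDE.IsMaximalSmoothSolution ν 0 u p T →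
      Literature.Analysis.FluidPDE.IsLerayHopfOn T ν 0 (u 0) u →
      Literature.Analysis.FluidPDE.HasRapidSpatialDecay (u 0) →
      Filter.Tendsto (fun t => MeasureTheory.eLpNorm (u t - u T) 2 MeasureTheory.volume)
        (nhdsWithin T (Set.Iio T)) (nhds 0) →
      (∃ K T₁ : ℝ, T₁ < T ∧ ∀ t ∈ Set.Ioo T₁ T,
        ∫⁻ x, ‖u t x - u T x‖ₑ ^ 2 ≤ ENNReal.ofReal (K * Real.sqrt (T - t))) →
      ∀ γ : ℝ, γ < 1 → ∀ x₀ : EuclideanSpace ℝ (Fin 3), ∃ C ρ₁ : ℝ, 0 < ρ₁ ∧ ∀ ρ ∈ Set.Ioo 0 ρ₁,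
        ∫⁻ t in Set.Ioo (T - ρ ^ 2) T, ∫⁻ x in Metric.ball x₀ ρ,
          ENNReal.ofReal (frobeniusNormSq (fderiv ℝ (u t) x)) ≤ ENNReal.ofReal (C * ρ ^ γ) :=
  fun ν T hν hT u p hmax hLH hdec htame hclock =>
    MeanFieldBootstrap.critTameVertex_typeI_eps_of_meanFieldStep ν T hν hT u p hmax hLH hdec htame hclock
      (oneStepSchema_sqrt hν hT hmax.1 hLH hclock)

/-! ## §4 Clock rigidity `b ≤ 1/2`, unconditional -/

/-- ★★ **No clock of exponent `b > 1/2`** on U's frame (maximal smooth solution on `[0, T)`, Leray–Hopf on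
`[0, T]`, decaying datum, tame at `T`): a bound `∫‖u t − u T‖² ≤ K (T − t)^b` near `T` with `b > 1/2` is
contradictory — `MeanFieldClockRigidity.clockExponent_le_half_of_meanFieldStep` with its one-step antecedent
discharged by `oneStepSchema_b` (`b ≤ 1`) and `EnergyClockScarLaw.no_clock_above_one` (`b > 1`). [folklore] -/
theorem no_clock_above_half :
    ∀ (ν T : ℝ), 0 < ν → 0 < T → ∀ (u : ℝ → EuclideanSpace ℝ (Fin 3) → EuclideanSpace ℝ (Fin 3))
      (p : ℝ → EuclideanSpace ℝ (Fin 3) → ℝ),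
      Literature.Analysis.FluidPDE.IsMaximalSmoothSolution ν 0 u p T →
      Literature.Analysis.FluidPDE.IsLerayHopfOn T ν 0 (u 0) u →
      Literature.Analysis.FluidPDE.HasRapidSpatialDecay (u 0) →
      Filter.Tendsto (fun t => MeasureTheory.eLpNorm (u t - u T) 2 MeasureTheory.volume)
        (nhdsWithin T (Set.Iio T)) (nhds 0) →
      ∀ b : ℝ, 1 / 2 < b →
      (∃ K T₁ : ℝ, T₁ < T ∧ ∀ t ∈ Set.Ioo T₁ T,
        ∫⁻ x, ‖u t x - u T x‖ₑ ^ 2 ≤ ENNReal.ofReal (K * (T - t) ^ b)) →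
      False :=
  fun ν T hν hT u p hmax hLH hdec htame b hb hclock =>
    MeanFieldClockRigidity.clockExponent_le_half_of_meanFieldStep ν T hν hT u p hmax hLH hdec htame b hb
      hclock (oneStepSchema_b hν hT hmax.1 hLH hb hclock)

/-- **Clock rigidity `b ≤ 1/2`** (contrapositive form): on U's frame, tame at `T`, every clock
`∫‖u t − u T‖² ≤ K (T − t)^b` valid near `T` has exponent `b ≤ 1/2`. [folklore] -/
theorem clockExponent_le_half {ν T : ℝ} (hν : 0 < ν) (hT : 0 < T)
    {u : ℝ → EuclideanSpace ℝ (Fin 3) → EuclideanSpace ℝ (Fin 3)} {p : ℝ → EuclideanSpace ℝ (Fin 3) → ℝ}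
    (hmax : IsMaximalSmoothSolution ν 0 u p T) (hLH : IsLerayHopfOn T ν 0 (u 0) u)
    (hdec : HasRapidSpatialDecay (u 0))
    (htame : Tendsto (fun t => eLpNorm (u t - u T) 2 volume) (𝓝[<] T) (𝓝 0))
    {b : ℝ} (hclock : ∃ K T₁ : ℝ, T₁ < T ∧ ∀ t ∈ Ioo T₁ T,
      ∫⁻ x, ‖u t x - u T x‖ₑ ^ 2 ≤ ENNReal.ofReal (K * (T - t) ^ b)) :
    b ≤ 1 / 2 :=
  not_lt.1 fun hb => no_clock_above_half ν T hν hT u p hmax hLH hdec htame b hb hclock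

end MeanFieldUnconditional
end Summit.NavierStokesRegularity.NavierStokesRegularity.Theorems
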